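import Literature.NumberTheory.Automorphic.NormOneIdeleClassCompact
import Literature.NumberTheory.Automorphic.IdeleClassGroupProofs
import Literature.NumberTheory.Automorphic.IdeleClassGroupAutomorphicQuotientProofs
import Literature.NumberTheory.Automorphic.AdelicSecondCountable
import Literature.NumberTheory.Automorphic.QuaternionAlgebraAdelicProofs
import Mathlib.MeasureTheory.Group.LIntegral
import Mathlib.MeasureTheory.Group.Action
import HarnessLib

/-!
# Unfolding dyadic idele shells over `Kˣ`

Topic `NumberTheory/Automorphic`; namespace `Literature.NumberTheory.Automorphic`. A brick of the
mean-square route to Jacquet–Shalika's Theorem (5.3) for `GL₂`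
(`StandardLFunctionData.multipliable_L`; files `JacquetShalikaSchurSelfSum`, `WhittakerBesselGL2`,
`UnipotentTateDomain`): Hecke's unfolding of a sum over `ξ ∈ Kˣ` against an integral over a set of
representatives of a shell of the idele class group into an integral over the whole shell of the
idele group `𝕀_K = 𝔸_Kˣ`. Concretely:

* `lintegral_le_lintegral_tsum_of_subset_iUnion_smul` — **abstract unfolding inequality**: for a
  left-invariant measure `μ` on a group `G` with measurable multiplication, a countable
  family `γ : ι → G`, a measurable `Y ⊆ G` and `A ⊆ ⋃ᵢ γᵢ • Y`,
  `∫⁻_A F dμ ≤ ∫⁻_Y ∑'ᵢ F(γᵢ y) dμ(y)` for every measurable `F ≥ 0` (Tonelli and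
  `∑ᵢ 1_Y(γᵢ⁻¹ y) ≥ 1` on `A`);
* `dyadicIdeleSet K r` — a **compact set of representatives** `Y_r = z(r) · P · W ⊆ 𝕀_K`, where
  `z(r) = posRealIdele K r` (`r ∈ ℝ_{>0}` diagonally at the archimedean places), `P = z([2^{-1/d},
  4^{1/d}])`, `d = [K : ℚ]`, and `W = ⋃_{t ∈ T} t̃ · B_t` is the compact set of the idelic proof of
  the compactness of `𝕀_K¹ / Kˣ` (`exists_finset_normBox_of_ideleNorm_eq_one` of
  `NormOneIdeleClassCompact`: `𝕀_K¹ = W · Kˣ`); it is a translate of the fixed compact set `Y_1`, so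
  its Haar measure does not depend on `r`;
* `exists_mul_mem_dyadicIdeleSet` — **covering**: every idele of norm in `[r^d/2, 4 r^d]` is
  `k · y` with `k ∈ Kˣ` and `y ∈ Y_r`;
* `snd_mem_of_mem_dyadicIdeleSet` — off a finite set `S_W` of finite places (depending only on
  `K`, through `T`), the elements of `Y_r` are local units;
* `lintegral_shell_le_lintegral_dyadicIdeleSet_tsum` — the unfolding inequality for the shell
  `{‖y‖ ∈ [r^d/2, 4 r^d]}`: `∫⁻_{shell} F ≤ ∫⁻_{Y_r} ∑'_{k ∈ Kˣ} F(k y) dμ(y)`.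

Everything is proved; folklore (Hecke's integral representation and Rankin's unfolding on `GL₁`:
Tate (1950), §4.4; Weil, *Basic Number Theory* (1967), Ch. IV §4; Jacquet–Langlands (1970), §11).

## References

* J. Tate, *Fourier analysis in number fields and Hecke's zeta-functions* (1950), §4.4, in
  Cassels–Fröhlich (eds.), *Algebraic Number Theory* (1967), Ch. XV [CasselsFrohlichANT1967].
* A. Weil, *Basic Number Theory* (1967), Ch. IV §4 [WeilBNT1967].
-/

noncomputable section

open MeasureTheory Measure NumberField IsDedekindDomain Set Filter
open scoped ENNReal NNReal Pointwise Topology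

namespace Literature.NumberTheory.Automorphic

/-! ### The abstract unfolding inequality -/

section Abstract

variable {G : Type*} [Group G] [MeasurableSpace G] [MeasurableMul G] (μ : Measure G)
  [μ.IsMulLeftInvariant]

/-- **Unfolding a countable covering.** Let `μ` be a left-invariant measure on a group
`G` with measurable multiplication, `γ : ι → G` a countable family, `Y` measurable and
`A ⊆ ⋃ᵢ γᵢ • Y`. Then for every measurable `F : G → ℝ≥0∞`,
`∫⁻_A F dμ ≤ ∫⁻_Y ∑'ᵢ F(γᵢ y) dμ(y)`: by Tonelli and left invariance the right-hand side is
`∫⁻ F(y) · #{i | γᵢ⁻¹ y ∈ Y} dμ(y)`, and the multiplicity is `≥ 1` on `A`. [folklore] -/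
theorem lintegral_le_lintegral_tsum_of_subset_iUnion_smul {ι : Type*} [Countable ι] (γ : ι → G)
    {Y A : Set G} (hY : MeasurableSet Y) (hAm : MeasurableSet A) (hA : A ⊆ ⋃ i, γ i • Y)
    {F : G → ℝ≥0∞} (hF : Measurable F) :
    ∫⁻ y in A, F y ∂μ ≤ ∫⁻ y in Y, ∑' i, F (γ i * y) ∂μ := by
  -- rewrite the right-hand side by Tonelli and left invariance
  have hmeas : ∀ i, Measurable fun y => F (γ i * y) := fun i => hF.comp (measurable_const_mul _)
  have hrhs : ∫⁻ y in Y, ∑' i, F (γ i * y) ∂μ = ∫⁻ y, F y * ∑' i, (γ i • Y).indicator 1 y ∂μ := by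
    rw [← lintegral_indicator hY]
    have h1 : (fun y => Y.indicator (fun y => ∑' i, F (γ i * y)) y) =
        fun y => ∑' i, Y.indicator (fun y => F (γ i * y)) y := by
      funext y
      by_cases hy : y ∈ Y
      · simp only [indicator_of_mem hy]
      · simp only [indicator_of_notMem hy, tsum_zero]
    rw [h1, lintegral_tsum fun i => ((hmeas i).indicator hY).aemeasurable]
    have h2 : ∀ i, ∫⁻ y, Y.indicator (fun y => F (γ i * y)) y ∂μ =
        ∫⁻ y, F y * (γ i • Y).indicator 1 y ∂μ := by
      intro i
      have h3 : (fun y => F y * (γ i • Y).indicator 1 y) =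
          fun y => (fun z => Y.indicator (fun z => F (γ i * z)) z) ((γ i)⁻¹ * y) := by
        funext y
        change F y * (γ i • Y).indicator 1 y = Y.indicator (fun z => F (γ i * z)) ((γ i)⁻¹ * y)
        by_cases hy : (γ i)⁻¹ * y ∈ Y
        · have hy' : y ∈ γ i • Y := by
            rw [mem_smul_set_iff_inv_smul_mem, smul_eq_mul]; exact hy
          rw [indicator_of_mem hy', indicator_of_mem hy, Pi.one_apply, mul_one, mul_inv_cancel_left]
        · have hy' : y ∉ γ i • Y := by
            rw [mem_smul_set_iff_inv_smul_mem, smul_eq_mul]; exact hy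
          rw [indicator_of_notMem hy', indicator_of_notMem hy, mul_zero]
      rw [h3, lintegral_mul_left_eq_self]
    simp_rw [h2]
    rw [← lintegral_tsum (f := fun i y => F y * (γ i • Y).indicator 1 y) fun i =>
      (hF.mul (measurable_const.indicator (hY.const_smul _))).aemeasurable]
    refine lintegral_congr fun y => ?_
    rw [ENNReal.tsum_mul_left]
  rw [hrhs]
  -- on `A` the multiplicity `∑ᵢ 1_{γᵢ Y}` is at least `1`
  calc ∫⁻ y in A, F y ∂μ ≤ ∫⁻ y in A, F y * ∑' i, (γ i • Y).indicator 1 y ∂μ := by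
        refine setLIntegral_mono' hAm fun y hy => ?_
        obtain ⟨i, hi⟩ := mem_iUnion.1 (hA hy)
        calc F y = F y * 1 := (mul_one _).symm
          _ ≤ F y * ∑' i, (γ i • Y).indicator 1 y := by
            gcongr
            calc (1 : ℝ≥0∞) = (γ i • Y).indicator 1 y := by rw [indicator_of_mem hi, Pi.one_apply]
              _ ≤ ∑' i, (γ i • Y).indicator 1 y := ENNReal.le_tsum i
    _ ≤ ∫⁻ y, F y * ∑' i, (γ i • Y).indicator 1 y ∂μ := setLIntegral_le_lintegral _ _

end Abstract

/-! ### The idele group: local compactness, second countability -/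

section Idelic

variable (K : Type) [Field K] [NumberField K]

/-- `𝕀_K = 𝔸_Kˣ` (units topology) is locally compact (`𝔸_K` is a locally compact Hausdorff
ring, `locallyCompactSpace_adeleRing'`). [folklore] -/
theorem locallyCompactSpace_ideleGroup : LocallyCompactSpace (GaloisRepresentations.ideleGroup K) := by
  haveI := locallyCompactSpace_adeleRing' K
  haveI := t2Space_ideleGroup K
  haveI : T2Space (AdeleRing (𝓞 K) K) := t2Space_adeleRing K
  infer_instance

/-- `𝕀_K` is second countable (`𝔸_K` is, `secondCountableTopology_adeleRing`). [folklore] -/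
theorem secondCountableTopology_ideleGroup :
    SecondCountableTopology (GaloisRepresentations.ideleGroup K) := by
  haveI := secondCountableTopology_adeleRing K
  haveI : SecondCountableTopology (AdeleRing (𝓞 K) K)ᵐᵒᵖ :=
    MulOpposite.opHomeomorph.symm.secondCountableTopology
  exact Units.isEmbedding_embedProduct.secondCountableTopology

/-- Lang's real-valued idele norm (`NormOneIdeleClassCompact`, `LangWave0`) is the coercion of the
`ℝ≥0`-valued one (`IdeleClassGroup.ideleNorm`) — the same expression (`coe_ideleNorm`). [folklore] -/
theorem langIdeleNorm_eq_coe (x : GaloisRepresentations.ideleGroup K) :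
    Literature.NumberTheory.Automorphic.LangWave0.ideleNorm K x = (IdeleClassGroup.ideleNorm K x : ℝ) := by
  rw [coe_ideleNorm]; rfl

/-! ### The compact set `W` with `𝕀_K¹ = W · Kˣ`, off a finite set of places its elements are units -/

/-- The set of finite places where a finite idele or its inverse fails to be integral is finite
(restricted product). [folklore] -/
theorem finite_setOf_not_integral (t : (FiniteAdeleRing (𝓞 K) K)ˣ) :
    {v : HeightOneSpectrum (𝓞 K) | ¬ ((t : FiniteAdeleRing (𝓞 K) K) v ∈ v.adicCompletionIntegers K ∧
      ((t⁻¹ : (FiniteAdeleRing (𝓞 K) K)ˣ) : FiniteAdeleRing (𝓞 K) K) v ∈ v.adicCompletionIntegers K)}.Finite := by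
  have h1 : ∀ᶠ v in cofinite, (t : FiniteAdeleRing (𝓞 K) K) v ∈ v.adicCompletionIntegers K :=
    (t : FiniteAdeleRing (𝓞 K) K).2
  have h2 : ∀ᶠ v in cofinite,
      ((t⁻¹ : (FiniteAdeleRing (𝓞 K) K)ˣ) : FiniteAdeleRing (𝓞 K) K) v ∈ v.adicCompletionIntegers K :=
    ((t⁻¹ : (FiniteAdeleRing (𝓞 K) K)ˣ) : FiniteAdeleRing (𝓞 K) K).2
  have h := h1.and h2
  rwa [Filter.eventually_cofinite] at h

/-- **`𝕀_K¹ = W · Kˣ` with `W` compact and almost everywhere unramified.** There is a compact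
`W ⊆ 𝕀_K` of norm-one ideles and a finite set `S_W` of finite places such that every norm-one
idele is `w · k` with `w ∈ W`, `k ∈ Kˣ`, and every `w ∈ W` is a local unit at every `v ∉ S_W`.
This repackages `exists_finset_normBox_of_ideleNorm_eq_one` (`NormOneIdeleClassCompact`:
`W = ⋃_{t ∈ T} t̃ · B(‖t̃‖⁻¹, R_t, R'_t)`, boxes of ideles integral with their inverses at all finite
places; `S_W` = the places where some `t ∈ T` is not a unit). Cassels–Fröhlich, Ch. II §16 Theorem
(`J¹/kˣ` compact) in the form of §18, (18.3). [cite: CasselsFrohlichANT1967, Ch. II §16 Theorem] -/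
theorem exists_isCompact_normOne_cover :
    ∃ W : Set (GaloisRepresentations.ideleGroup K), IsCompact W ∧
      (∀ w ∈ W, IdeleClassGroup.ideleNorm K w = 1) ∧
      (∀ x : GaloisRepresentations.ideleGroup K, IdeleClassGroup.ideleNorm K x = 1 →
        ∃ k : Kˣ, ∃ w ∈ W, x = w * principalIdele K k) ∧
      ∃ S : Finset (HeightOneSpectrum (𝓞 K)), ∀ w ∈ W, ∀ v ∉ S,
        (w : AdeleRing (𝓞 K) K).2 v ∈ v.adicCompletionIntegers K ∧
          ((w⁻¹ : GaloisRepresentations.ideleGroup K) : AdeleRing (𝓞 K) K).2 v ∈ v.adicCompletionIntegers K := by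
  classical
  obtain ⟨T, R, R', hT⟩ := exists_finset_normBox_of_ideleNorm_eq_one K
  set B : (FiniteAdeleRing (𝓞 K) K)ˣ → Set (GaloisRepresentations.ideleGroup K) := fun t =>
    normBox K (Literature.NumberTheory.Automorphic.LangWave0.ideleNorm K (finiteIdele K t))⁻¹ (R t) (R' t)
    with hB
  set W : Set (GaloisRepresentations.ideleGroup K) := ⋃ t ∈ T, finiteIdele K t • B t with hW
  have hnorm_t : ∀ t, Literature.NumberTheory.Automorphic.LangWave0.ideleNorm K (finiteIdele K t) ≠ 0 :=
    fun t => (ideleNorm_pos (finiteIdele K t)).ne'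
  refine ⟨W, ?_, ?_, ?_, ?_⟩
  · -- compact: a finite union of translates of compact boxes
    refine T.finite_toSet.isCompact_biUnion fun t _ => ?_
    exact (isCompact_normBox K _ _ _).smul (finiteIdele K t)
  · -- norm one
    intro w hw
    obtain ⟨t, ht, hw⟩ := mem_iUnion₂.1 hw
    obtain ⟨z, hz, rfl⟩ := mem_smul_set.1 hw
    apply NNReal.coe_injective
    rw [NNReal.coe_one, ← langIdeleNorm_eq_coe, smul_eq_mul, ideleNorm_mul, ideleNorm_eq_of_mem_normBox hz,
      mul_inv_cancel₀ (hnorm_t t)]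
  · -- covering
    intro x hx
    have hx' : Literature.NumberTheory.Automorphic.LangWave0.ideleNorm K x = 1 := by
      rw [langIdeleNorm_eq_coe, hx, NNReal.coe_one]
    obtain ⟨t, ht, k, z, hz, hxeq⟩ := hT x hx'
    exact ⟨k, finiteIdele K t * z, mem_iUnion₂.2 ⟨t, ht, smul_mem_smul_set hz⟩, hxeq⟩
  · -- integrality off a finite set of places
    set S : Finset (HeightOneSpectrum (𝓞 K)) :=
      (Finite.biUnion' T.finite_toSet fun t _ => finite_setOf_not_integral K t).toFinset with hS
    refine ⟨S, fun w hw v hv => ?_⟩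
    obtain ⟨t, ht, hw⟩ := mem_iUnion₂.1 hw
    obtain ⟨z, hz, rfl⟩ := mem_smul_set.1 hw
    have hvt : (t : FiniteAdeleRing (𝓞 K) K) v ∈ v.adicCompletionIntegers K ∧
        ((t⁻¹ : (FiniteAdeleRing (𝓞 K) K)ˣ) : FiniteAdeleRing (𝓞 K) K) v ∈ v.adicCompletionIntegers K := by
      by_contra hcon
      apply hv
      rw [hS, Finite.mem_toFinset]
      exact mem_iUnion₂.2 ⟨t, ht, hcon⟩
    obtain ⟨hzfin, -, -⟩ := hz
    refine ⟨?_, ?_⟩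
    · rw [smul_eq_mul, Units.val_mul]
      change (finiteIdele K t : AdeleRing (𝓞 K) K).2 v * (z : AdeleRing (𝓞 K) K).2 v ∈ _
      exact mul_mem hvt.1 (hzfin v).1
    · rw [smul_eq_mul, mul_inv_rev, Units.val_mul]
      change ((z⁻¹ : GaloisRepresentations.ideleGroup K) : AdeleRing (𝓞 K) K).2 v *
        (((finiteIdele K t)⁻¹ : GaloisRepresentations.ideleGroup K) : AdeleRing (𝓞 K) K).2 v ∈ _
      exact mul_mem (hzfin v).2 hvt.2

/-- **A compact transversal-cover of the norm-one ideles modulo `Kˣ`** (a choice of `W` in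
`exists_isCompact_normOne_cover`). [folklore] -/
def normOneIdeleCover : Set (GaloisRepresentations.ideleGroup K) :=
  (exists_isCompact_normOne_cover K).choose

/-- `W` is compact. [folklore] -/
theorem isCompact_normOneIdeleCover : IsCompact (normOneIdeleCover K) :=
  (exists_isCompact_normOne_cover K).choose_spec.1

/-- Elements of `W` have norm one. [folklore] -/
theorem ideleNorm_eq_one_of_mem_normOneIdeleCover {w : GaloisRepresentations.ideleGroup K}
    (hw : w ∈ normOneIdeleCover K) : IdeleClassGroup.ideleNorm K w = 1 :=
  (exists_isCompact_normOne_cover K).choose_spec.2.1 w hw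

/-- Every norm-one idele is `w · k`, `w ∈ W`, `k ∈ Kˣ`. [cite: CasselsFrohlichANT1967, Ch. II §16 Theorem] -/
theorem exists_mem_normOneIdeleCover_mul_principalIdele {x : GaloisRepresentations.ideleGroup K}
    (hx : IdeleClassGroup.ideleNorm K x = 1) :
    ∃ k : Kˣ, ∃ w ∈ normOneIdeleCover K, x = w * principalIdele K k :=
  (exists_isCompact_normOne_cover K).choose_spec.2.2.1 x hx

/-- Off a finite set of finite places, the elements of `W` are local units. [folklore] -/
theorem exists_finset_integral_of_mem_normOneIdeleCover :
    ∃ S : Finset (HeightOneSpectrum (𝓞 K)), ∀ w ∈ normOneIdeleCover K, ∀ v ∉ S,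
      (w : AdeleRing (𝓞 K) K).2 v ∈ v.adicCompletionIntegers K ∧
        ((w⁻¹ : GaloisRepresentations.ideleGroup K) : AdeleRing (𝓞 K) K).2 v ∈ v.adicCompletionIntegers K :=
  (exists_isCompact_normOne_cover K).choose_spec.2.2.2

/-! ### Positive real ideles of norm in `[1/2, 4]` -/

/-- `t ↦ e^t` as a unit of `ℝ≥0`. [folklore] -/
def expUnitNNReal (t : ℝ) : ℝ≥0ˣ where
  val := ⟨Real.exp t, (Real.exp_pos t).le⟩
  inv := ⟨Real.exp (-t), (Real.exp_pos (-t)).le⟩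
  val_inv := Subtype.ext (by change Real.exp t * Real.exp (-t) = 1; rw [← Real.exp_add, add_neg_cancel, Real.exp_zero])
  inv_val := Subtype.ext (by change Real.exp (-t) * Real.exp t = 1; rw [← Real.exp_add, neg_add_cancel, Real.exp_zero])

/-- `(expUnitNNReal t : ℝ) = e^t`. [folklore] -/
@[simp]
theorem coe_expUnitNNReal (t : ℝ) : (((expUnitNNReal t : ℝ≥0ˣ) : ℝ≥0) : ℝ) = Real.exp t := rfl

/-- `t ↦ expUnitNNReal t` is continuous into the units topology. [folklore] -/
theorem continuous_expUnitNNReal : Continuous expUnitNNReal := by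
  refine Units.continuous_iff.2 ⟨?_, ?_⟩
  · exact Continuous.subtype_mk Real.continuous_exp _
  · exact Continuous.subtype_mk (Real.continuous_exp.comp continuous_neg) _

/-- The **positive real ideles of norm in `[1/2, 4]`**: `P = {z(e^t) : -log 2 / d ≤ t ≤ log 4 / d}`,
`d = [K : ℚ]`, `z = posRealIdele K`. [folklore] -/
def posRealIdeleSegment : Set (GaloisRepresentations.ideleGroup K) :=
  (fun t : ℝ => posRealIdele K (expUnitNNReal t)) ''
    Icc (-(Real.log 2) / Module.finrank ℚ K) (Real.log 4 / Module.finrank ℚ K)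

/-- `P` is compact. [folklore] -/
theorem isCompact_posRealIdeleSegment : IsCompact (posRealIdeleSegment K) :=
  isCompact_Icc.image ((continuous_posRealIdele K).comp continuous_expUnitNNReal)

/-- The norm of `z(e^t)` is `e^{d t}`. [folklore] -/
theorem ideleNorm_posRealIdele_expUnitNNReal (t : ℝ) :
    (IdeleClassGroup.ideleNorm K (posRealIdele K (expUnitNNReal t)) : ℝ) =
      Real.exp (Module.finrank ℚ K * t) := by
  rw [ideleNorm_posRealIdele_holds K, NNReal.coe_pow, coe_expUnitNNReal, ← Real.exp_nat_mul]

/-- Every `c ∈ [1/2, 4]` is the norm of an element of `P`. [folklore] -/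
theorem exists_mem_posRealIdeleSegment_ideleNorm_eq {c : ℝ} (hc : 1 / 2 ≤ c) (hc' : c ≤ 4) :
    ∃ p ∈ posRealIdeleSegment K, (IdeleClassGroup.ideleNorm K p : ℝ) = c := by
  have hd : (0 : ℝ) < Module.finrank ℚ K := Nat.cast_pos.2 Module.finrank_pos
  have hcpos : 0 < c := lt_of_lt_of_le (by norm_num) hc
  have hlog : -Real.log 2 ≤ Real.log c := by
    rw [← Real.log_inv]
    exact Real.log_le_log (by norm_num) (by rw [inv_eq_one_div]; exact hc)
  refine ⟨posRealIdele K (expUnitNNReal (Real.log c / Module.finrank ℚ K)), ⟨_, ⟨?_, ?_⟩, rfl⟩, ?_⟩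
  · exact div_le_div_of_nonneg_right hlog hd.le
  · exact div_le_div_of_nonneg_right (Real.log_le_log hcpos hc') hd.le
  · rw [ideleNorm_posRealIdele_expUnitNNReal, mul_div_cancel₀ _ hd.ne', Real.exp_log hcpos]

/-- Norms of elements of `P` lie in `[1/2, 4]`. [folklore] -/
theorem ideleNorm_mem_of_mem_posRealIdeleSegment {p : GaloisRepresentations.ideleGroup K}
    (hp : p ∈ posRealIdeleSegment K) :
    1 / 2 ≤ (IdeleClassGroup.ideleNorm K p : ℝ) ∧ (IdeleClassGroup.ideleNorm K p : ℝ) ≤ 4 := by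
  obtain ⟨t, ⟨ht1, ht2⟩, rfl⟩ := hp
  have hd : (0 : ℝ) < Module.finrank ℚ K := Nat.cast_pos.2 Module.finrank_pos
  rw [ideleNorm_posRealIdele_expUnitNNReal]
  constructor
  · have h : Real.log (1 / 2) ≤ Module.finrank ℚ K * t := by
      rw [one_div, Real.log_inv]
      exact (div_le_iff₀' hd).1 ht1
    calc (1 : ℝ) / 2 = Real.exp (Real.log (1 / 2)) := (Real.exp_log (by norm_num)).symm
      _ ≤ Real.exp (Module.finrank ℚ K * t) := Real.exp_le_exp.2 h
  · have h : Module.finrank ℚ K * t ≤ Real.log 4 := (le_div_iff₀' hd).1 ht2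
    calc Real.exp (Module.finrank ℚ K * t) ≤ Real.exp (Real.log 4) := Real.exp_le_exp.2 h
      _ = 4 := Real.exp_log (by norm_num)

/-- Finite components of elements of `P` are `1`. [folklore] -/
theorem snd_eq_one_of_mem_posRealIdeleSegment {p : GaloisRepresentations.ideleGroup K}
    (hp : p ∈ posRealIdeleSegment K) : (p : AdeleRing (𝓞 K) K).2 = 1 := by
  obtain ⟨t, -, rfl⟩ := hp
  exact posRealIdele_snd K _

/-! ### The dyadic sets of representatives `Y_r = z(r) · P · W` -/

/-- **The dyadic set of representatives** `Y_r = z(r) · (P · W) ⊆ 𝕀_K` of the shell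
`{‖y‖ ∈ [r^d/2, 4 r^d]}` of the idele class group: a left translate, by the positive real idele
`z(r)`, of the fixed compact set `P · W`. [folklore] -/
def dyadicIdeleSet (r : ℝ≥0ˣ) : Set (GaloisRepresentations.ideleGroup K) :=
  posRealIdele K r • (posRealIdeleSegment K * normOneIdeleCover K)

/-- `Y_r` is compact. [folklore] -/
theorem isCompact_dyadicIdeleSet (r : ℝ≥0ˣ) : IsCompact (dyadicIdeleSet K r) :=
  ((isCompact_posRealIdeleSegment K).mul (isCompact_normOneIdeleCover K)).smul _

/-- `Y_r` is closed (hence Borel). [folklore] -/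
theorem isClosed_dyadicIdeleSet (r : ℝ≥0ˣ) : IsClosed (dyadicIdeleSet K r) := by
  haveI := t2Space_ideleGroup K
  exact (isCompact_dyadicIdeleSet K r).isClosed

/-- Norms on `Y_r` lie in `[r^d/2, 4 r^d]`. [folklore] -/
theorem ideleNorm_mem_of_mem_dyadicIdeleSet {r : ℝ≥0ˣ} {y : GaloisRepresentations.ideleGroup K}
    (hy : y ∈ dyadicIdeleSet K r) :
    ((r : ℝ≥0) : ℝ) ^ Module.finrank ℚ K / 2 ≤ (IdeleClassGroup.ideleNorm K y : ℝ) ∧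
      (IdeleClassGroup.ideleNorm K y : ℝ) ≤ 4 * ((r : ℝ≥0) : ℝ) ^ Module.finrank ℚ K := by
  obtain ⟨x, hx, rfl⟩ := mem_smul_set.1 hy
  obtain ⟨p, hp, w, hw, rfl⟩ := mem_mul.1 hx
  obtain ⟨h1, h2⟩ := ideleNorm_mem_of_mem_posRealIdeleSegment K hp
  have hrd : 0 ≤ ((r : ℝ≥0) : ℝ) ^ Module.finrank ℚ K := by positivity
  rw [smul_eq_mul, map_mul, map_mul, ideleNorm_eq_one_of_mem_normOneIdeleCover K hw, mul_one,
    ideleNorm_posRealIdele_holds K, NNReal.coe_mul, NNReal.coe_pow]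
  constructor
  · rw [div_eq_mul_one_div]
    exact mul_le_mul_of_nonneg_left h1 hrd
  · rw [mul_comm 4]
    exact mul_le_mul_of_nonneg_left h2 hrd

/-- **Covering**: every idele of norm in `[r^d/2, 4 r^d]` is `k · y` with `k ∈ Kˣ` (diagonally
embedded, `principalIdele`) and `y ∈ Y_r`. Proof: scale by `z(r)⁻¹` and by the inverse of a point
of `P` of the right norm to land in `𝕀_K¹ = W · Kˣ`. [cite: CasselsFrohlichANT1967, Ch. II §16 Theorem] -/
theorem exists_principalIdele_mul_mem_dyadicIdeleSet (r : ℝ≥0ˣ) {x : GaloisRepresentations.ideleGroup K}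
    (hx : ((r : ℝ≥0) : ℝ) ^ Module.finrank ℚ K / 2 ≤ (IdeleClassGroup.ideleNorm K x : ℝ))
    (hx' : (IdeleClassGroup.ideleNorm K x : ℝ) ≤ 4 * ((r : ℝ≥0) : ℝ) ^ Module.finrank ℚ K) :
    ∃ k : Kˣ, ∃ y ∈ dyadicIdeleSet K r, x = principalIdele K k * y := by
  have hrpos : 0 < ((r : ℝ≥0) : ℝ) := by
    have : (r : ℝ≥0) ≠ 0 := r.ne_zero
    positivity
  have hrd : 0 < ((r : ℝ≥0) : ℝ) ^ Module.finrank ℚ K := pow_pos hrpos _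
  have hN : (IdeleClassGroup.ideleNorm K x : ℝ) ≠ 0 := NNReal.coe_ne_zero.2 (ideleNorm_ne_zero x)
  set c : ℝ := (IdeleClassGroup.ideleNorm K x : ℝ) / ((r : ℝ≥0) : ℝ) ^ Module.finrank ℚ K with hc
  have hc1 : 1 / 2 ≤ c := by
    rw [hc, le_div_iff₀ hrd]; linarith
  have hc2 : c ≤ 4 := by
    rw [hc, div_le_iff₀ hrd]; linarith
  obtain ⟨p, hp, hpc⟩ := exists_mem_posRealIdeleSegment_ideleNorm_eq K hc1 hc2
  have hcpos : 0 < c := lt_of_lt_of_le (by norm_num) hc1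
  -- the norm-one idele `x z(r)⁻¹ p⁻¹`
  set x₁ : GaloisRepresentations.ideleGroup K := x * (posRealIdele K r)⁻¹ * p⁻¹ with hx₁
  have hx₁n : IdeleClassGroup.ideleNorm K x₁ = 1 := by
    apply NNReal.coe_injective
    rw [hx₁, map_mul, map_mul, map_inv, map_inv, NNReal.coe_mul, NNReal.coe_mul, NNReal.coe_inv,
      NNReal.coe_inv, hpc, ideleNorm_posRealIdele_holds K, NNReal.coe_pow, NNReal.coe_one]
    rw [hc]
    field_simp
  obtain ⟨k, w, hw, hx₁eq⟩ := exists_mem_normOneIdeleCover_mul_principalIdele K hx₁n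
  refine ⟨k, posRealIdele K r * (p * w), smul_mem_smul_set (mul_mem_mul hp hw), ?_⟩
  calc x = x₁ * (posRealIdele K r * p) := by
        rw [hx₁]
        symm
        calc x * (posRealIdele K r)⁻¹ * p⁻¹ * (posRealIdele K r * p)
            = x * ((posRealIdele K r)⁻¹ * posRealIdele K r) * (p⁻¹ * p) := by ac_rfl
          _ = x := by rw [inv_mul_cancel, inv_mul_cancel, mul_one, mul_one]
    _ = w * principalIdele K k * (posRealIdele K r * p) := by rw [hx₁eq]
    _ = principalIdele K k * (posRealIdele K r * (p * w)) := by ac_rfl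

/-- The shell `{‖x‖ ∈ [r^d/2, 4 r^d]}` is covered by the `Kˣ`-translates of `Y_r`. [folklore] -/
theorem shell_subset_iUnion_smul_dyadicIdeleSet (r : ℝ≥0ˣ) :
    {x : GaloisRepresentations.ideleGroup K |
        ((r : ℝ≥0) : ℝ) ^ Module.finrank ℚ K / 2 ≤ (IdeleClassGroup.ideleNorm K x : ℝ) ∧
          (IdeleClassGroup.ideleNorm K x : ℝ) ≤ 4 * ((r : ℝ≥0) : ℝ) ^ Module.finrank ℚ K} ⊆
      ⋃ k : Kˣ, principalIdele K k • dyadicIdeleSet K r := by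
  rintro x ⟨hx, hx'⟩
  obtain ⟨k, y, hy, rfl⟩ := exists_principalIdele_mul_mem_dyadicIdeleSet K r hx hx'
  exact mem_iUnion.2 ⟨k, smul_mem_smul_set hy⟩

/-- **Off a finite set of places the representatives are units**: there is a finite set `S_W` of
finite places (depending only on `K`) such that for every `r` and every `y ∈ Y_r`, `y_v` and
`y_v⁻¹` are `v`-integral for all `v ∉ S_W`. [folklore] -/
theorem exists_finset_integral_of_mem_dyadicIdeleSet :
    ∃ S : Finset (HeightOneSpectrum (𝓞 K)), ∀ (r : ℝ≥0ˣ), ∀ y ∈ dyadicIdeleSet K r, ∀ v ∉ S,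
      (y : AdeleRing (𝓞 K) K).2 v ∈ v.adicCompletionIntegers K ∧
        ((y⁻¹ : GaloisRepresentations.ideleGroup K) : AdeleRing (𝓞 K) K).2 v ∈ v.adicCompletionIntegers K := by
  obtain ⟨S, hS⟩ := exists_finset_integral_of_mem_normOneIdeleCover K
  refine ⟨S, fun r y hy v hv => ?_⟩
  obtain ⟨x, hx, rfl⟩ := mem_smul_set.1 hy
  obtain ⟨p, hp, w, hw, rfl⟩ := mem_mul.1 hx
  obtain ⟨hw1, hw2⟩ := hS w hw v hv
  have hp1 : (p : AdeleRing (𝓞 K) K).2 v = 1 := by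
    rw [snd_eq_one_of_mem_posRealIdeleSegment K hp]; rfl
  have hp2 : ((p⁻¹ : GaloisRepresentations.ideleGroup K) : AdeleRing (𝓞 K) K).2 v = 1 := by
    simpa only [hp1, one_mul] using idele_snd_apply_mul_inv p v
  have hr1 : ((posRealIdele K r : GaloisRepresentations.ideleGroup K) : AdeleRing (𝓞 K) K).2 v = 1 := by
    rw [posRealIdele_snd K r]; rfl
  have hr2 : (((posRealIdele K r)⁻¹ : GaloisRepresentations.ideleGroup K) : AdeleRing (𝓞 K) K).2 v = 1 := by
    rw [← map_inv, posRealIdele_snd K r⁻¹]; rfl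
  constructor
  · rw [smul_eq_mul, idele_snd_mul_apply, idele_snd_mul_apply, hr1, hp1, one_mul, one_mul]
    exact hw1
  · rw [smul_eq_mul, mul_inv_rev, mul_inv_rev, idele_snd_mul_apply, idele_snd_mul_apply, hp2, hr2,
      mul_one, mul_one]
    exact hw2

/-! ### Haar measure on `𝕀_K` and the unfolding inequality for the shell -/

section Measure

variable [MeasurableSpace (GaloisRepresentations.ideleGroup K)] [BorelSpace (GaloisRepresentations.ideleGroup K)]

/-- `Y_r` is a Borel set. [folklore] -/
theorem measurableSet_dyadicIdeleSet (r : ℝ≥0ˣ) : MeasurableSet (dyadicIdeleSet K r) :=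
  (isClosed_dyadicIdeleSet K r).measurableSet

/-- The shell `{‖x‖ ∈ [a, b]}` is a Borel set (the idele norm is continuous,
`continuous_ideleNorm_holds`). [folklore] -/
theorem measurableSet_shell (a b : ℝ) :
    MeasurableSet {x : GaloisRepresentations.ideleGroup K |
      a ≤ (IdeleClassGroup.ideleNorm K x : ℝ) ∧ (IdeleClassGroup.ideleNorm K x : ℝ) ≤ b} := by
  have hc : Continuous fun x : GaloisRepresentations.ideleGroup K => (IdeleClassGroup.ideleNorm K x : ℝ) :=
    NNReal.continuous_coe.comp (continuous_ideleNorm_holds K)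
  exact ((isClosed_le continuous_const hc).inter (isClosed_le hc continuous_const)).measurableSet

omit [BorelSpace (GaloisRepresentations.ideleGroup K)] in
/-- **The Haar measure of `Y_r` does not depend on `r`** (a left translate of the fixed set
`P · W`), for every left-invariant measure. [folklore] -/
theorem measure_dyadicIdeleSet (μ : Measure (GaloisRepresentations.ideleGroup K)) [μ.IsMulLeftInvariant]
    (r : ℝ≥0ˣ) : μ (dyadicIdeleSet K r) = μ (posRealIdeleSegment K * normOneIdeleCover K) :=
  measure_smul μ _ _

omit [BorelSpace (GaloisRepresentations.ideleGroup K)] in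
/-- `Y_r` has finite measure for every measure finite on compact sets. [folklore] -/
theorem measure_dyadicIdeleSet_lt_top (μ : Measure (GaloisRepresentations.ideleGroup K))
    [IsFiniteMeasureOnCompacts μ] (r : ℝ≥0ˣ) : μ (dyadicIdeleSet K r) < ⊤ :=
  (isCompact_dyadicIdeleSet K r).measure_lt_top

/-- **Unfolding the dyadic shell over `Kˣ`** (Hecke, Rankin): for every left-invariant measure
`μ` on `𝕀_K`, every `r ∈ ℝ_{>0}` and every measurable `F ≥ 0`,
`∫⁻_{‖x‖ ∈ [r^d/2, 4 r^d]} F dμ ≤ ∫⁻_{Y_r} ∑'_{k ∈ Kˣ} F(k y) dμ(y)`. [folklore] -/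
theorem lintegral_shell_le_lintegral_dyadicIdeleSet_tsum (μ : Measure (GaloisRepresentations.ideleGroup K))
    [μ.IsMulLeftInvariant] (r : ℝ≥0ˣ) {F : GaloisRepresentations.ideleGroup K → ℝ≥0∞} (hF : Measurable F) :
    ∫⁻ x in {x : GaloisRepresentations.ideleGroup K |
        ((r : ℝ≥0) : ℝ) ^ Module.finrank ℚ K / 2 ≤ (IdeleClassGroup.ideleNorm K x : ℝ) ∧
          (IdeleClassGroup.ideleNorm K x : ℝ) ≤ 4 * ((r : ℝ≥0) : ℝ) ^ Module.finrank ℚ K}, F x ∂μ ≤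
      ∫⁻ y in dyadicIdeleSet K r, ∑' k : Kˣ, F (principalIdele K k * y) ∂μ := by
  haveI : Countable Kˣ := by
    haveI := countable_numberField K
    exact Function.Injective.countable (f := (Units.val : Kˣ → K)) Units.val_injective
  exact lintegral_le_lintegral_tsum_of_subset_iUnion_smul μ (fun k : Kˣ => principalIdele K k)
    (measurableSet_dyadicIdeleSet K r) (measurableSet_shell K _ _)
    (shell_subset_iUnion_smul_dyadicIdeleSet K r) hF

end Measure

end Idelic

end Literature.NumberTheory.Automorphic
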